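import Summits.Schanuel.Schanuel.Theorems.RootDecomp1KRunge05

/-!
# RootDecomp1KRunge — lens 1, generation 57, NODE 18 «RUNGE ON THE K-LINE» (2-adic Runge's method at x = ∞; RULE K-R48 payable clause; CLAIM L2698, PRICE L2701, K-R49) — continuation (RootDecomp1KRunge06): §9 territory (section Territory)

(lens-1 g57 NODE 18 HOME kernel K = HOME/decomp-schanuel-lens-1/g57/Runge.lean 42801ffe…, 1394 l, 113 thm + structure RungeCert + integer-table defs, imports tree …RootDecomp1KParamThueMahler03 ONLY = the port of node 17 (no Literature import, no fact def, no private; two local `set_option maxHeartbeats … in` as in K); Probe / Ctrl0 / Ctrl + NODE-g57.md + SHA256SUMS; CLAIM L2698, census LIVENESS-v8 L2699 (of record L2701) / LIVENESS-v9 L2703, writer CHECK NOTE L2700 (certificate arithmetic reproduces), crit g10 EX-ANTE PRICE L2701 (ONE THEOREM ×1 for (A) engine + (B) binder discharge thinFibreAt_M17P + (C) the family RW jointly iff CHECKLIST K-g57 (1)–(10); RULE K-R49 pre-announced), NODE L2704, critic VERDICT L2711 (crit g10): CLEARED — THEOREM ×1 (joint (A) engine + (B) binder discharge + (C) the family RW),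 ex-ante PRICE L2701 met 10/10, prong «infinite class of positive-genus re-amended-frontier pairs made unconditional» (K-R48 PAYABLE), rung 0; RULE K-R49 FIXED (toolkit of record ∪= 2-adic Runge certificates — the `RungeCert k c` engine `thinFibreAt_of_rungeCert`; FRONTIER re-amended by «NOT Runge-certifiable», Runge-certifiable(m₀,P) := ((deg topX < natDegree ∨ topX ℚ-reducible) ∧ eTop+1 ≤ m₀) ∨ natDegree < m₀·xdeg; standing open-territory witness W4 (census TM33)); PORT GO exactly as STAGING NOTE 8 L2708 with the port edits (a)–(d) SANCTIONED; writer RE-CHECK L2709. Port by census-1 gen 22 as `RootDecomp1KRunge01–06` (`--supports stmt-Schanuel-33364`; no census credit): 01 = §0 small facts (local copies of private tree lemmas), §1 integer coefficient tables `ev` / `ev₁` / `tabAbs`, §2 the level polynomial `ptilde` vanishing at (t_N, r) (`tQ N = 2^N!/p_N`); 02 = §3 THE 2-ADIC RUNGE ESTIMATE `runge_small` (‖Φ(t_N, r)‖₂ ≤ K·2^(−M·N!)), §4 the integer `zInt` (product formula), §5 the arithmetic endgame; 03 = §6 `structure RungeCert k c` (integral two-polynomial Runge certificate) and THE ENGINE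 **`thinFibreAt_of_rungeCert`**; 04 = §7 the member M17P: tables `m17G … m17rho`, `m17Cert : RungeCert 2 m17C`, **`thinFibreAt_M17P_runge : 2 ≤ m₀ → ThinFibreAt m₀ M17P` HYPOTHESIS-FREE** (the tree's `thinFibreAt_M17P (hS : PadicSubspace)` loses its binder); 05 = §8 the infinite class `RW w = xPolyP 5 (rwC w)` (deg w ≤ 3), the w-free certificate `rwCert`, **`thinFibreAt_RW`**, members `RW1/RW2/RW3`; 06 = §9 TERRITORY certificates by tree names (section Territory). PORT EDITS (head dry-run near-duplicate notes resolved before filing, as in the node-14/15 ports): TWO delete-for-twin in §0 — K's `partialSum_two_runge` (≡ `RootDecomp1KLevelFinite.lac_partialSum_two`, LevelFinite12) and K's `norm_two_runge` (≡ `RootDecomp1KLocalExponent.norm_two_Cp`, LocalExponent01), each single use re-pointed to the tree name; TWO privatisations with file-local copies where a later part uses them — K's `norm_intCast_le_one_runge` and `norm_intCast_two_runge` (near-duplicates of BirchSwinnertonDyer decls); 62 one-line docstrings on undocumented computation lemmas (statements quoted); K's two local `set_option maxHeartbeats N in` kept verbatim; nothing else; provenance doc blocks + continuation headers = K's own open-lines;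 statements and proofs VERBATIM. Rung 0 — nothing here proves Schanuel, 33364, 33363, 31077 or ThinFibre 2; everything HYPOTHESIS-FREE.)
-/

noncomputable section

namespace Summit.Schanuel.Schanuel.Theorems.RootDecomp1KRunge

open Polynomial LiouvilleNumber
open scoped Nat
open Summit.Schanuel.Schanuel.Theorems.RootDecomp1KTwoBaseCell (psNumer partialSum_eq_psNumer_div coprime_psNumer)
open Summit.Schanuel.Schanuel.Theorems.RootDecomp1KRelLiouvilleCell (partialSum_two_strictMono
  partialSum_two_lt_liouvilleNumber)
open Summit.Schanuel.Schanuel.Theorems.RootDecomp1KDegreeLadder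
open Summit.Schanuel.Schanuel.Theorems.RootDecomp1KXLinearCore
open Summit.Schanuel.Schanuel.Theorems.RootDecomp1KXLinear
open Summit.Schanuel.Schanuel.Theorems.RootDecomp1KXLinearII
open Summit.Schanuel.Schanuel.Theorems.RootDecomp1KXTop
open Summit.Schanuel.Schanuel.Theorems.RootDecomp1KSubspaceBranch

/-! ### §9 TERRITORY — where the members sit relative to EVERY class decided in the tree (by tree names), and why the
record could not decide them at `m₀ = 2`: separable top `Y² − 17` with the IRRATIONAL SIMPLE `ℚ₂`-roots `±√17` (rate 1,
exponent `½` of record — Ridout), `eTop = 1`; NOT `DecidedAt 2` / `LocalAt 2` / `GaussAt 2` / `XLinTM` / two-term /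
norm-shape / x-linear; IN the two CONDITIONAL classes (`SepTopAt 2` ⟸ `PadicSubspace`, node 11; the height-inequality shape
`deg_Y < 2·xdeg` ⟸ `HeightComparison`, node 12).  Runge needs NO exponent: the integer `Z` VANISHES. -/

section Territory

open Summit.Schanuel.Schanuel.Theorems.RootDecomp1KXAll
open Summit.Schanuel.Schanuel.Theorems.RootDecomp1KLevelFinite
open Summit.Schanuel.Schanuel.Theorems.RootDecomp1KLocalExponent
open Summit.Schanuel.Schanuel.Theorems.RootDecomp1KIntegrality
open Summit.Schanuel.Schanuel.Theorems.RootDecomp1KThueMahler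

/-- `Y² − 17` has NO RATIONAL ROOT (`√17 ∉ ℚ`). -/
theorem aeval_m17C_two_ne_zero_rat (q : ℚ) : aeval q (m17C 2) ≠ 0 := by
  rw [m17C_two, map_sub, map_pow, aeval_X, aeval_C, eq_intCast, Int.cast_ofNat, sub_ne_zero]
  intro h
  have h' : ((q : ℝ)) ^ 2 = 17 := by exact_mod_cast congrArg (fun t : ℚ => (t : ℝ)) h
  have hirr : Irrational (Real.sqrt (17 : ℝ)) := by
    simpa using Nat.Prime.irrational_sqrt (by norm_num : Nat.Prime 17)
  exact hirr ⟨|q|, by rw [Rat.cast_abs, ← Real.sqrt_sq_eq_abs, h']⟩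

/-! #### `M17P` (the standing frontier witness of record, census TM17, genus 2) -/

/-- `: xdeg M17P = 2`. -/
theorem xdeg_M17P : xdeg M17P = 2 := xdeg_xPolyP 2 m17C m17C_two_ne_zero
/-- `: topX M17P = m17C 2`. -/
theorem topX_M17P : topX M17P = m17C 2 := topX_xPolyP 2 m17C m17C_two_ne_zero
/-- `: M17P.natDegree = 3`. -/
theorem natDegree_M17P : M17P.natDegree = 3 := by
  refine le_antisymm (natDegree_xPolyP_le 2 m17C 3 fun j hj => ?_) three_le_natDegree_M17P
  interval_cases j
  · rw [natDegree_m17C_zero]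
  · rw [natDegree_m17C_one]
  · rw [natDegree_m17C_two]; norm_num
/-- `: eTop M17P = 1`. -/
theorem eTop_M17P : eTop M17P = 1 := by
  rw [eTop, natDegree_M17P, topX_M17P, natDegree_m17C_two]
/-- `(g q : ℤ[X]) (n : ℕ) (D : ℤ) : M17P ≠ normShapeCurve g q n D`. -/
theorem M17P_ne_normShapeCurve (g q : ℤ[X]) (n : ℕ) (D : ℤ) : M17P ≠ normShapeCurve g q n D := by
  rw [normShapeCurve_eq_xLinP]; exact M17P_ne_xLinP _ _

/-- **`M17P` — TERRITORY AND THE THEOREM, by tree names:** `x`-degree 2, `Y`-degree 3, the top `Y² − 17` has a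
`ℚ₂`-root and no rational root and is separable, `eTop = 1`; `¬ DecidedAt 2` (SubspaceBranch04), `¬ LocalAt 2`
(LocalExponent05), `¬ GaussAt 2` (Integrality04), `¬ XLinTM` (ThueMahler04), `¬ XLinearLt`, no x-linear / two-term /
norm-shape presentation, `3 ≤ thinThreshold`; it IS in the CONDITIONAL classes `SepTopAt 2` (node 11 ⟸ `PadicSubspace`)
and `deg_Y = 3 < 4 = 2·xdeg` (node 12's height-inequality shape ⟸ `HeightComparison`) — AND NOW `ThinFibreAt m₀ M17P`
for every `m₀ ≥ 2`, hypothesis-free. -/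
theorem M17P_territory :
    xdeg M17P = 2 ∧ M17P.natDegree = 3 ∧ (∃ z : ℚ_[2], aeval z (topX M17P) = 0) ∧ (∀ q : ℚ, aeval q (topX M17P) ≠ 0) ∧
      ((topX M17P).map (Int.castRingHom ℚ)).Separable ∧ eTop M17P = 1 ∧
      ¬ DecidedAt 2 M17P ∧ ¬ LocalAt 2 M17P ∧ ¬ GaussAt 2 M17P ∧ ¬ XLinTM M17P ∧ ¬ XLinearLt M17P ∧
      (∀ A B, M17P ≠ xLinP A B) ∧ (∀ k B A, M17P ≠ twoTermP k B A) ∧ (∀ g q n D, M17P ≠ normShapeCurve g q n D) ∧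
      3 ≤ thinThreshold M17P ∧ SepTopAt 2 M17P ∧ M17P.natDegree < 2 * xdeg M17P ∧
      ∀ m₀, 2 ≤ m₀ → ThinFibreAt m₀ M17P := by
  refine ⟨xdeg_M17P, natDegree_M17P, ?_, ?_, ?_, eTop_M17P, not_decidedAt_two_M17P, not_localAt_two_M17P,
    not_gaussAt_M17P 2, not_xLinTM_M17P, not_xLinearLt_M17P, M17P_ne_xLinP, M17P_ne_twoTermP, M17P_ne_normShapeCurve,
    three_le_thinThreshold _, sepTopAt_two_M17P, ?_, fun m₀ hm => thinFibreAt_M17P_runge hm⟩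
  · rw [topX_M17P]; exact exists_padic_root_m17C_two
  · rw [topX_M17P]; exact aeval_m17C_two_ne_zero_rat
  · rw [topX_M17P]; exact separable_m17C_two
  · rw [natDegree_M17P, xdeg_M17P]; norm_num

/-! #### `RW w`, uniformly in `w` (`deg w ≤ 3` where the `Y`-degree matters) -/

/-- `(w : ℤ[X]) : xdeg (RW w) = 5`. -/
theorem xdeg_RW (w : ℤ[X]) : xdeg (RW w) = 5 := xdeg_xPolyP 5 _ (rwC_five_ne_zero w)
/-- `(w : ℤ[X]) : topX (RW w) = m17C 2`. -/
theorem topX_RW (w : ℤ[X]) : topX (RW w) = m17C 2 := by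
  rw [RW, topX_xPolyP 5 _ (rwC_five_ne_zero w), rwC_five_eq_m17C_two]
/-- `(w : ℤ[X]) (j : ℕ) : xCoeff (RW w) j = rwC w j`. -/
theorem xCoeff_RW (w : ℤ[X]) (j : ℕ) : xCoeff (RW w) j = rwC w j := by
  rw [RW, xCoeff_xPolyP]
  split_ifs with h
  · rfl
  · exact (rwC_of_gt w (by omega)).symm
/-- `w` is read off `RW w` as its `x⁰`-coefficient: the class is injectively parametrised by `w`. -/
theorem RW_injective : Function.Injective RW := fun w₁ w₂ h => by
  have := congrArg (fun P => xCoeff P 0) h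
  simpa only [xCoeff_RW, rwC_zero] using this
/-- `(w : ℤ[X]) : 3 ≤ (RW w).natDegree`. -/
theorem three_le_natDegree_RW (w : ℤ[X]) : 3 ≤ (RW w).natDegree := by
  refine le_natDegree_of_ne_zero fun h => ?_
  have h1 := congrArg (fun q : ℤ[X] => q.coeff 4) h
  simp only [RW, coeff_coeff_xPolyP, coeff_zero] at h1
  rw [if_pos (by simp), rwC_four] at h1
  simp [coeff_X, coeff_one] at h1
/-- `(w : ℤ[X]) (hw : w.natDegree ≤ 3) : (RW w).natDegree = 3`. -/
theorem natDegree_RW (w : ℤ[X]) (hw : w.natDegree ≤ 3) : (RW w).natDegree = 3 := by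
  refine le_antisymm (natDegree_xPolyP_le 5 _ 3 fun j hj => ?_) (three_le_natDegree_RW w)
  interval_cases j
  · rw [rwC_zero]; exact hw
  · rw [rwC_one]; compute_degree
  · rw [rwC_two]; compute_degree; norm_num
  · rw [rwC_three]; compute_degree; norm_num
  · rw [rwC_four]; compute_degree
  · rw [rwC_five]; compute_degree; norm_num
/-- `(w : ℤ[X]) : RW w ≠ 0`. -/
theorem RW_ne_zero (w : ℤ[X]) : RW w ≠ 0 := fun h => by
  have := three_le_natDegree_RW w; rw [h, natDegree_zero] at this; omega
/-- `(w : ℤ[X]) (hw : w.natDegree ≤ 3) : eTop (RW w) = 1`. -/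
theorem eTop_RW (w : ℤ[X]) (hw : w.natDegree ≤ 3) : eTop (RW w) = 1 := by
  rw [eTop, natDegree_RW w hw, topX_RW, natDegree_m17C_two]

/-- `RW w` has NO x-linear presentation. -/
theorem RW_ne_xLinP (w A B : ℤ[X]) : RW w ≠ xLinP A B := by
  intro hP
  have h := fun x : ℝ => congrArg (fun Q => bev Q x 0) hP
  have h0 := h 0
  have h1 := h 1
  have h2 := h 2
  simp only [bev_RW, bev_xLinP] at h0 h1 h2
  have : (-494 : ℝ) = 0 := by linear_combination h0 - 2 * h1 + h2
  norm_num at this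
/-- `(w : ℤ[X]) : ¬ XLinearLt (RW w)`. -/
theorem not_xLinearLt_RW (w : ℤ[X]) : ¬ XLinearLt (RW w) := fun ⟨A, B, _, _, hP⟩ => RW_ne_xLinP w A B hP
/-- outside node 16's record class (x-linear by statement). -/
theorem not_xLinTM_RW (w : ℤ[X]) : ¬ XLinTM (RW w) := fun ⟨A, B, _, _, _, _, hP⟩ => RW_ne_xLinP w A B hP
/-- not a conjugate-poles norm shape of node 10 (those are x-linear). -/
theorem RW_ne_normShapeCurve (w g q : ℤ[X]) (n : ℕ) (D : ℤ) : RW w ≠ normShapeCurve g q n D := by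
  rw [normShapeCurve_eq_xLinP]; exact RW_ne_xLinP w _ _
/-- not a two-term curve `x^k·B(Y) − A(Y)` (the `x`-support of `RW w` contains `{1, 2, 3, 4, 5}`). -/
theorem RW_ne_twoTermP (w : ℤ[X]) (k : ℕ) (B A : ℤ[X]) : RW w ≠ twoTermP k B A := by
  intro h
  have hc : ∀ i j : ℕ, (if j ∈ Finset.range 6 then (rwC w j).coeff i else 0) =
      ((if j = k then B.coeff i else 0) - (if j = 0 then A.coeff i else 0)) := by
    intro i j
    rw [← coeff_coeff_xPolyP, ← coeff_coeff_twoTermP, ← h]; rfl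
  by_cases hk : k = 1
  · subst hk
    have h02 := hc 0 2
    rw [if_pos (by simp), if_neg (by norm_num), if_neg (by norm_num), rwC_two] at h02
    simp at h02
  · have h01 := hc 0 1
    rw [if_pos (by simp), if_neg (fun h => hk h.symm), if_neg (by norm_num), rwC_one] at h01
    simp at h01
/-- in EVERY presentation `RW w = Σ_{j ≤ k} x^j c_j(Y)` the top has a `ℚ₂`-root (it is `Y² − 17` or `0`). -/
theorem exists_padic_root_top_of_RW_eq (w : ℤ[X]) (k : ℕ) (c : ℕ → ℤ[X]) (h : RW w = xPolyP k c) :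
    ∃ z : ℚ_[2], aeval z (c k) = 0 := by
  by_cases hck : c k = 0
  · exact ⟨0, by rw [hck, map_zero]⟩
  · have h1 := topX_RW w
    rw [h, topX_xPolyP k c hck] at h1
    rw [h1]; exact exists_padic_root_m17C_two
/-- `(w : ℤ[X]) (e : ℕ) : ¬ RootlessTop e (RW w)`. -/
theorem not_rootlessTop_RW (w : ℤ[X]) (e : ℕ) : ¬ RootlessTop e (RW w) := by
  rintro ⟨k, c, -, hroot, h⟩
  obtain ⟨z, hz⟩ := exists_padic_root_top_of_RW_eq w k c h
  exact hroot z hz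
/-- **`¬ DecidedAt 2 (RW w)`** — each of the five disjuncts refuted. -/
theorem not_decidedAt_two_RW (w : ℤ[X]) : ¬ DecidedAt 2 (RW w) := by
  rintro (h | h | h | h | h)
  · have := three_le_natDegree_RW w; omega
  · exact not_xLinearLt_RW w h
  · exact absurd h.1 (by norm_num)
  · have := three_le_thinThreshold (RW w); omega
  · exact not_rootlessTop_RW w 1 h
/-- **`¬ LocalAt m₀ (RW w)` for `m₀ ≤ 2`** (tree `rootCond_topX_of_localAt` + `not_rootCond_m17C_two`). -/
theorem not_localAt_RW (w : ℤ[X]) {m₀ : ℕ} (hm : m₀ ≤ 2) : ¬ LocalAt m₀ (RW w) := fun h => by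
  have hR := rootCond_topX_of_localAt h
  rw [topX_RW] at hR
  exact not_rootCond_m17C_two hm hR
/-- **`¬ GaussAt m₀ (RW w)`** at ANY `m₀` (dominance fails at `j = 4`: `deg c₄ = 3 ≥ deg w`). -/
theorem not_gaussAt_RW (w : ℤ[X]) (hw : w.natDegree ≤ 3) (m₀ : ℕ) : ¬ GaussAt m₀ (RW w) := by
  intro h
  have := ((gaussAt_xPolyP_iff 5 (rwC w) (rwC_five_ne_zero w)).mp h).1 4 (by norm_num) (by norm_num)
  rw [natDegree_rwC_four, rwC_zero] at this
  omega
/-- … while `RW w` IS in node 11's CONDITIONAL class at `m₀ = 2` (separable top, `eTop = 1`). -/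
theorem sepTopAt_two_RW (w : ℤ[X]) (hw : w.natDegree ≤ 3) : SepTopAt 2 (RW w) := by
  refine ⟨?_, ?_⟩
  · rw [topX_RW]; exact separable_m17C_two
  · rw [eTop_RW w hw]
/-- … and satisfies node 12's height INEQUALITY `deg_Y = 3 < 10 = 2·xdeg` (HONEST: so `RW w` is conditional of record
via `HeightComparison` too, given geometric irreducibility; `HeightComparison` is NOT proved here). -/
theorem natDegree_RW_lt_two_mul_xdeg (w : ℤ[X]) (hw : w.natDegree ≤ 3) : (RW w).natDegree < 2 * xdeg (RW w) := by
  rw [natDegree_RW w hw, xdeg_RW]; norm_num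

/-- **THE INFINITE x-DEGREE-5 CLASS OF RE-AMENDED-FRONTIER MEMBERS MADE UNCONDITIONAL, uniform in `w ∈ ℤ[Y]`,
`deg w ≤ 3`:** `x`-degree 5, `Y`-degree 3, separable top `Y² − 17` with an irrational `ℚ₂`-root and no rational root,
`eTop = 1`; `¬ DecidedAt 2`, `¬ LocalAt 2`, `¬ GaussAt 2`, `¬ XLinTM`, `¬ XLinearLt`, not x-linear / two-term / norm
shape, `3 ≤ thinThreshold`; IN the conditional classes `SepTopAt 2` and `deg_Y < 2·xdeg` — AND `ThinFibreAt m₀ (RW w)`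
for every `m₀ ≥ 2`.  (Genus 8 for the three named members; positive genus off a proper Zariski-closed set of `w` —
certified in the memo, not in Lean.) -/
theorem RW_territory (w : ℤ[X]) (hw : w.natDegree ≤ 3) :
    xdeg (RW w) = 5 ∧ (RW w).natDegree = 3 ∧ (∃ z : ℚ_[2], aeval z (topX (RW w)) = 0) ∧
      (∀ q : ℚ, aeval q (topX (RW w)) ≠ 0) ∧ ((topX (RW w)).map (Int.castRingHom ℚ)).Separable ∧ eTop (RW w) = 1 ∧
      ¬ DecidedAt 2 (RW w) ∧ ¬ LocalAt 2 (RW w) ∧ ¬ GaussAt 2 (RW w) ∧ ¬ XLinTM (RW w) ∧ ¬ XLinearLt (RW w) ∧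
      (∀ A B, RW w ≠ xLinP A B) ∧ (∀ k B A, RW w ≠ twoTermP k B A) ∧ (∀ g q n D, RW w ≠ normShapeCurve g q n D) ∧
      3 ≤ thinThreshold (RW w) ∧ SepTopAt 2 (RW w) ∧ (RW w).natDegree < 2 * xdeg (RW w) ∧
      ∀ m₀, 2 ≤ m₀ → ThinFibreAt m₀ (RW w) := by
  refine ⟨xdeg_RW w, natDegree_RW w hw, ?_, ?_, ?_, eTop_RW w hw, not_decidedAt_two_RW w, not_localAt_RW w le_rfl,
    not_gaussAt_RW w hw 2, not_xLinTM_RW w, not_xLinearLt_RW w, RW_ne_xLinP w, RW_ne_twoTermP w, RW_ne_normShapeCurve w,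
    three_le_thinThreshold _, sepTopAt_two_RW w hw, natDegree_RW_lt_two_mul_xdeg w hw, fun m₀ hm => thinFibreAt_RW w hw hm⟩
  · rw [topX_RW]; exact exists_padic_root_m17C_two
  · rw [topX_RW]; exact aeval_m17C_two_ne_zero_rat
  · rw [topX_RW]; exact separable_m17C_two

/-- the three named members are pairwise distinct. -/
theorem RW1_ne_RW2_ne_RW3 : RW1 ≠ RW2 ∧ RW2 ≠ RW3 ∧ RW1 ≠ RW3 := by
  refine ⟨fun h => ?_, fun h => ?_, fun h => ?_⟩
  · have := congrArg (fun q : ℤ[X] => q.coeff 3) (RW_injective h); simp [coeff_X] at this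
  · have := congrArg (fun q : ℤ[X] => q.coeff 0) (RW_injective h); simp [coeff_X] at this
  · have := congrArg (fun q : ℤ[X] => q.coeff 0) (RW_injective h); simp at this

end Territory

end Summit.Schanuel.Schanuel.Theorems.RootDecomp1KRunge

end
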